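import Mathlib.Analysis.SpecialFunctions.Gamma.Basic
import Mathlib.Analysis.SpecialFunctions.Pow.Real
import Mathlib.MeasureTheory.Constructions.Pi
import Mathlib.MeasureTheory.Integral.Bochner.Basic
import Mathlib.MeasureTheory.Measure.Lebesgue.Basic
import HarnessLib

/-!
# The Selberg integral (Selberg 1944)

P. J. Forrester, S. O. Warnaar, *The importance of the Selberg integral*, Bull. Amer. Math. Soc. 45
(2008) 489–534 (`ForresterWarnaar2008`; held: `lit paper:arxiv-0710.3981`, read at PDF p. 3),
eq. (1.1): "the Selberg integral

  `S_n(α, β, γ) := ∫₀¹ ⋯ ∫₀¹ ∏_{i=1}^n t_i^{α−1} (1 − t_i)^{β−1} ∏_{1≤i<j≤n} |t_i − t_j|^{2γ} dt₁ ⋯ dt_n`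
  `= ∏_{j=0}^{n−1} Γ(α + jγ) Γ(β + jγ) Γ(1 + (j+1)γ) / (Γ(α + β + (n + j − 1)γ) Γ(1 + γ))`.

The evaluation of this integral is valid for complex parameters `α, β, γ` such that
`Re(α) > 0, Re(β) > 0, Re(γ) > −min{1/n, Re(α)/(n−1), Re(β)/(n−1)}` (1.2), corresponding to the
domain of convergence of the integral" (A. Selberg, *Bemerkninger om et multipelt integral*, Norsk
Mat. Tidsskr. 26 (1944) 71–78; G. E. Andrews, R. Askey, R. Roy, *Special Functions* (1999),
Thm. 8.1.1, with Anderson's and Aomoto's proofs in §§8.2–8.4).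

Tree form: REAL parameters `a, b, c` (the case the period routes use: rational `a, b > 0`,
`c = 1/n`), the integral as the Bochner integral over the cube `[0,1]^n ⊂ (Fin n → ℝ)` for the
product Lebesgue measure (`MeasureTheory.volume`), real powers `Real.rpow`, `Real.Gamma`; the
convergence condition (1.2) is written division-free as `−1/n < c`, `−a < (n−1)c`, `−b < (n−1)c`
(for `n = 1` the last two are vacuous, as `min{1, ∞, ∞}` in print). Under (1.2) the integral
converges absolutely, so the Bochner integral is the classical value. Named fact (D-0014,
`selberg_integral_formula`), values only; wanted by route
`Summits/KontsevichZagierPeriods/KontsevichZagierPeriods/Theses/SelbergAMGM.lean` (cruxes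
`SelbergCollapseOneThird`, `DuplicationProductForm`: numerical anchors `S₃(a,b;1/3)`,
`S₂(a,b;1/2)`), not load-bearing there. Not here: Aomoto's and Kadell's extensions, the
Mehta/Macdonald–Morris constant terms (FW §1), Anderson's Dirichlet-type lemma (AAR §8.4).
-/

noncomputable section

open MeasureTheory Real Finset

namespace Literature.Analysis.SpecialFunctions

/-- **The Selberg integral** `S_n(a, b, c) = ∫_{[0,1]^n} ∏ᵢ tᵢ^{a−1} (1 − tᵢ)^{b−1}
∏_{i<j} |tᵢ − tⱼ|^{2c} dt` (real parameters; Bochner integral for the product Lebesgue measure on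
`Fin n → ℝ` over the closed unit cube; junk `0` where not integrable).
[cite: ForresterWarnaar2008, eq. (1.1)] -/
def selbergIntegral (n : ℕ) (a b c : ℝ) : ℝ :=
  ∫ t in Set.pi Set.univ (fun _ : Fin n => Set.Icc (0 : ℝ) 1),
    (∏ i : Fin n, t i ^ (a - 1) * (1 - t i) ^ (b - 1)) *
      ∏ i : Fin n, ∏ j ∈ univ.filter (fun j : Fin n => i < j), |t i - t j| ^ (2 * c)

/-- **Selberg's product** `∏_{j=0}^{n−1} Γ(a + jc) Γ(b + jc) Γ(1 + (j+1)c) /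
(Γ(a + b + (n + j − 1)c) Γ(1 + c))`, the value of `S_n(a, b, c)`.
[cite: ForresterWarnaar2008, eq. (1.1)] -/
def selbergProduct (n : ℕ) (a b c : ℝ) : ℝ :=
  ∏ j ∈ range n,
    Gamma (a + j * c) * Gamma (b + j * c) * Gamma (1 + (j + 1) * c) /
      (Gamma (a + b + ((n : ℝ) + j - 1) * c) * Gamma (1 + c))

/-- Unfolding lemma for `selbergIntegral`. [folklore] -/
theorem selbergIntegral_def (n : ℕ) (a b c : ℝ) :
    selbergIntegral n a b c =
      ∫ t in Set.pi Set.univ (fun _ : Fin n => Set.Icc (0 : ℝ) 1),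
        (∏ i : Fin n, t i ^ (a - 1) * (1 - t i) ^ (b - 1)) *
          ∏ i : Fin n, ∏ j ∈ univ.filter (fun j : Fin n => i < j), |t i - t j| ^ (2 * c) :=
  rfl

/-- `S₁(a, b, c)` has the Beta-integral shape and Selberg's product at `n = 1` is
`Γ(a)Γ(b)/Γ(a+b)` (the factor `Γ(1+c)` cancels when `Γ(1+c) ≠ 0`, e.g. `c > −1`).
[cite: AndrewsAskeyRoy1999, Thm. 8.1.1 (n = 1: Euler's Beta integral)] -/
theorem selbergProduct_one (a b c : ℝ) (hc : Gamma (1 + c) ≠ 0) :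
    selbergProduct 1 a b c = Gamma a * Gamma b / Gamma (a + b) := by
  simp only [selbergProduct, range_one, prod_singleton, Nat.cast_zero, zero_mul, add_zero,
    zero_add, one_mul, Nat.cast_one]
  rw [show ((1 : ℝ) - 1) * c = 0 by ring, add_zero]
  field_simp

/-- **Selberg's integral formula** (Selberg 1944; Forrester–Warnaar (1.1)–(1.2); Andrews–Askey–Roy
Thm. 8.1.1), real parameters: for `n ≥ 1`, `a, b > 0` and `c > −min{1/n, a/(n−1), b/(n−1)}`
(division-free: `−1/n < c`, `−a < (n−1)c`, `−b < (n−1)c`),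
`S_n(a, b, c) = ∏_{j=0}^{n−1} Γ(a + jc)Γ(b + jc)Γ(1 + (j+1)c) / (Γ(a + b + (n+j−1)c)Γ(1 + c))`.
Named fact (D-0014), not proved in the tree (Selberg's / Anderson's / Aomoto's proofs, AAR Ch. 8).
[cite: ForresterWarnaar2008, eq. (1.1)–(1.2)] -/
def selberg_integral_formula : Prop :=
  ∀ (n : ℕ) (a b c : ℝ), 1 ≤ n → 0 < a → 0 < b →
    -(1 : ℝ) / n < c → -a < ((n : ℝ) - 1) * c → -b < ((n : ℝ) - 1) * c →
      selbergIntegral n a b c = selbergProduct n a b c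

end Literature.Analysis.SpecialFunctions

end
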